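import Summits.CriticalPhenomena.PercolationContinuityZ3.Theorems.PercNearOneGluingNoHeavyLowerTailSahiOneStepSubblockGridPrelim
import Summits.CriticalPhenomena.PercolationContinuityZ3.Theorems.PercNearOneGluingNoHeavyLowerTailSahiOneStepSubblockTransport
import HarnessLib

/-!
# One-step scheme, `(2′)` for sub-block thresholds — the GRID THEOREM (two chains, cylinder `B`, anti-diagonal `H`)

Support file (prover prim-ineq-prove-3 gen 20; `--supports stmt-CriticalPhenomena-4575`; memo
`run/shared/lean/prim/prim-ineq-prove-3/FINDING-G20-COUPLING-SPLIT.md` §2).  Pure finite-sum real inequality — the abstract form of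
THEOREM A of the memo.  Data: row weights `a k` (`k ≤ K`, total `1`), column weights `b j` (`j ≤ J`, total `1`), all nonnegative, and an array
`0 ≤ u k j ≤ a k · b j` that is nondecreasing "in conditional probability" along rows and columns:
(F1) `u k j · a k' ≤ u k' j · a k` (`k ≤ k'`), (F2) `u k j · b j' ≤ u k j' · b j` (`j ≤ j'`).  Regions of the grid: `L = {k + j < t}`,
`H = {t ≤ k + j}`, `B = {r ≤ k}`.  With `S(P) = Σ_P u`, `M(P) = Σ_P a·b`:
  **`0 ≤ S(L)·M(B ∩ L) + M(L)·S(H ∩ B) − M(L)·S(⊤)·M(B)`**   (`grid_osN_nonneg`).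
In the application (`…SubblockThreshold`, next file) `a, b` are the layer laws of `N_T`, `N_R`, `u k j = μ(U ∩ {N_T = k} ∩ {N_R = j})` for an
arbitrary increasing `U`, (F1)/(F2) come from `…SubblockLayer.real_inter_inter_layer_mul_le`, and the conclusion is
`0 ≤ osN p {N_F ≥ t} (1_U) (1_{N_T ≥ r})`, i.e. hypothesis `(2′)` of the one-step scheme for the pair (`U`, sub-block threshold).
Proof (memo §2): Step 1 `n = M(L)·X − S(L)·Y` (algebra); Step 2 `X ≥ T_u`, `Y = T_{ab}` (row monotonicity (F1)); Step 3
`M(L)·T_u ≥ S(L)·T_{ab}` by the level transport of `…SubblockTransport` fed with LEMMA S≤T of `…SubblockMediant` and two likelihood-ratio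
monotonicities of the column CDF `F(m) = Σ_{m+j<t} b_j`.
-/

namespace Summit.CriticalPhenomena.PercolationContinuityZ3.Theorems

namespace SahiOneStep

open Finset

/-! ## The main grid theorem -/

/-- **GRID THEOREM (abstract form of `(2′)` for a sub-block threshold).**  See the module docstring: for nonnegative row/column weights
`a, b` of total mass `1`, an array `0 ≤ u ≤ a ⊗ b` satisfying the row/column monotonicities (F1), (F2), a threshold `t` (the slot
`H = {t ≤ k+j}`, `L = Hᶜ`) and a cylinder `B = {r ≤ k}`:
`0 ≤ S(L)·M(B∩L) + M(L)·S(H∩B) − M(L)·S(⊤)·M(B)`. [this work] -/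
theorem grid_osN_nonneg (K J : ℕ) (a b : ℕ → ℝ) (u : ℕ → ℕ → ℝ) (r t : ℕ)
    (ha : ∀ k, 0 ≤ a k) (hb : ∀ j, 0 ≤ b j) (hu : ∀ k j, 0 ≤ u k j) (hub : ∀ k j, u k j ≤ a k * b j)
    (F1 : ∀ k k' j, k ≤ k' → u k j * a k' ≤ u k' j * a k) (F2 : ∀ k j j', j ≤ j' → u k j * b j' ≤ u k j' * b j)
    (hA1 : ∑ k ∈ range (K + 1), a k = 1) (hB1 : ∑ j ∈ range (J + 1), b j = 1) :
    0 ≤ (∑ k ∈ range (K + 1), ∑ j ∈ range (J + 1), if k + j < t then u k j else 0) *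
          (∑ k ∈ range (K + 1), ∑ j ∈ range (J + 1), if r ≤ k ∧ k + j < t then a k * b j else 0)
        + (∑ k ∈ range (K + 1), ∑ j ∈ range (J + 1), if k + j < t then a k * b j else 0) *
          (∑ k ∈ range (K + 1), ∑ j ∈ range (J + 1), if t ≤ k + j ∧ r ≤ k then u k j else 0)
        - (∑ k ∈ range (K + 1), ∑ j ∈ range (J + 1), if k + j < t then a k * b j else 0) *
          (∑ k ∈ range (K + 1), ∑ j ∈ range (J + 1), u k j) *
          (∑ k ∈ range (K + 1), ∑ j ∈ range (J + 1), if r ≤ k then a k * b j else 0) := by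
  -- if the cylinder is empty (`r > K`), every `B`-term vanishes
  by_cases hr : r ≤ K + 1
  swap
  · have hz1 : (∑ k ∈ range (K + 1), ∑ j ∈ range (J + 1), if r ≤ k ∧ k + j < t then a k * b j else 0) = 0 :=
      Finset.sum_eq_zero fun k hk => Finset.sum_eq_zero fun j _ => by
        rw [Finset.mem_range] at hk; rw [if_neg (fun h => by omega)]
    have hz2 : (∑ k ∈ range (K + 1), ∑ j ∈ range (J + 1), if t ≤ k + j ∧ r ≤ k then u k j else 0) = 0 :=
      Finset.sum_eq_zero fun k hk => Finset.sum_eq_zero fun j _ => by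
        rw [Finset.mem_range] at hk; rw [if_neg (fun h => by omega)]
    have hz3 : (∑ k ∈ range (K + 1), ∑ j ∈ range (J + 1), if r ≤ k then a k * b j else 0) = 0 :=
      Finset.sum_eq_zero fun k hk => Finset.sum_eq_zero fun j _ => by
        rw [Finset.mem_range] at hk; rw [if_neg (fun h => by omega)]
    rw [hz1, hz2, hz3]; simp
  -- names
  set N := J + 1 with hN
  set SUL := ∑ k ∈ range (K + 1), ∑ j ∈ range N, if k + j < t then u k j else 0 with hSUL
  set MBL := ∑ k ∈ range (K + 1), ∑ j ∈ range N, if r ≤ k ∧ k + j < t then a k * b j else 0 with hMBL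
  set ML := ∑ k ∈ range (K + 1), ∑ j ∈ range N, if k + j < t then a k * b j else 0 with hML
  set SUHB := ∑ k ∈ range (K + 1), ∑ j ∈ range N, if t ≤ k + j ∧ r ≤ k then u k j else 0 with hSUHB
  set SU := ∑ k ∈ range (K + 1), ∑ j ∈ range N, u k j with hSU
  set MB := ∑ k ∈ range (K + 1), ∑ j ∈ range N, if r ≤ k then a k * b j else 0 with hMB
  set SUHBc := ∑ k ∈ range (K + 1), ∑ j ∈ range N, if t ≤ k + j ∧ ¬ r ≤ k then u k j else 0 with hSUHBc
  set MHB := ∑ k ∈ range (K + 1), ∑ j ∈ range N, if t ≤ k + j ∧ r ≤ k then a k * b j else 0 with hMHB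
  set MHBc := ∑ k ∈ range (K + 1), ∑ j ∈ range N, if t ≤ k + j ∧ ¬ r ≤ k then a k * b j else 0 with hMHBc
  set A := ∑ k ∈ range (K + 1), if r ≤ k then a k else 0 with hA
  set Abar := ∑ k ∈ range (K + 1), if k < r then a k else 0 with hAbar
  -- nonnegativity
  have hSUL0 : 0 ≤ SUL := Finset.sum_nonneg fun k _ => Finset.sum_nonneg fun j _ => by split_ifs <;> simp [hu k j]
  have hML0 : 0 ≤ ML := Finset.sum_nonneg fun k _ => Finset.sum_nonneg fun j _ => by
    split_ifs <;> first | exact mul_nonneg (ha k) (hb j) | exact le_rfl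
  -- ### Step 1: the algebraic identity `n = ML·X − SUL·Y`
  have eAA : A + Abar = 1 := by
    rw [hA, hAbar, ← Finset.sum_add_distrib, ← hA1]
    refine Finset.sum_congr rfl fun k _ => ?_
    by_cases h : r ≤ k
    · rw [if_pos h, if_neg (by omega), add_zero]
    · rw [if_neg h, if_pos (by omega), zero_add]
  have eMB : MB = A := by
    rw [hMB, dsum_row_factor (K + 1) N (fun k => r ≤ k) a b, hN, hB1, mul_one]
  have eMtot : (∑ k ∈ range (K + 1), ∑ j ∈ range N, a k * b j) = 1 := by
    rw [← Finset.sum_mul_sum, hA1, hN, hB1, mul_one]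
  have eSU : SU = SUL + SUHB + SUHBc := by
    have h1 : SU = ∑ k ∈ range (K + 1), ∑ j ∈ range N, if True then u k j else 0 := by simp [hSU]
    rw [h1, dsum_split (K + 1) N (fun _ _ => True) (fun k j => k + j < t)]
    have h2 : (∑ k ∈ range (K + 1), ∑ j ∈ range N, if True ∧ k + j < t then u k j else 0) = SUL := by
      rw [hSUL]; refine Finset.sum_congr rfl fun k _ => Finset.sum_congr rfl fun j _ => by simp
    have h3 : (∑ k ∈ range (K + 1), ∑ j ∈ range N, if True ∧ ¬ k + j < t then u k j else 0) =
        ∑ k ∈ range (K + 1), ∑ j ∈ range N, if t ≤ k + j then u k j else 0 := by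
      refine Finset.sum_congr rfl fun k _ => Finset.sum_congr rfl fun j _ => ?_
      simp only [true_and, not_lt]
    rw [h2, h3, dsum_split (K + 1) N (fun k j => t ≤ k + j) (fun k _ => r ≤ k) u, hSUHB, hSUHBc]
    ring
  have eM : ML + MHB + MHBc = 1 := by
    rw [← eMtot]
    have h1 : (∑ k ∈ range (K + 1), ∑ j ∈ range N, a k * b j) =
        ∑ k ∈ range (K + 1), ∑ j ∈ range N, if True then a k * b j else 0 := by simp
    rw [h1, dsum_split (K + 1) N (fun _ _ => True) (fun k j => k + j < t)]
    have h2 : (∑ k ∈ range (K + 1), ∑ j ∈ range N, if True ∧ k + j < t then a k * b j else 0) = ML := by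
      rw [hML]; refine Finset.sum_congr rfl fun k _ => Finset.sum_congr rfl fun j _ => by simp
    have h3 : (∑ k ∈ range (K + 1), ∑ j ∈ range N, if True ∧ ¬ k + j < t then a k * b j else 0) =
        ∑ k ∈ range (K + 1), ∑ j ∈ range N, if t ≤ k + j then a k * b j else 0 := by
      refine Finset.sum_congr rfl fun k _ => Finset.sum_congr rfl fun j _ => ?_
      simp only [true_and, not_lt]
    rw [h2, h3, dsum_split (K + 1) N (fun k j => t ≤ k + j) (fun k _ => r ≤ k) (fun k j => a k * b j), hMHB, hMHBc]
    ring
  have eMBsplit : MB = MBL + MHB := by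
    rw [hMB, dsum_split (K + 1) N (fun k _ => r ≤ k) (fun k j => k + j < t) (fun k j => a k * b j), hMBL, hMHB]
    congr 1
    refine Finset.sum_congr rfl fun k _ => Finset.sum_congr rfl fun j _ => ?_
    by_cases h1 : r ≤ k <;> by_cases h2 : t ≤ k + j
    all_goals first
      | (have h3 : ¬ k + j < t := by omega
         simp [h1, h2, h3])
      | (have h3 : k + j < t := by omega
         simp [h1, h2, h3])
  -- Step 1
  have step1 : SUL * MBL + ML * SUHB - ML * SU * MB = ML * (Abar * SUHB - A * SUHBc) - SUL * (Abar * MHB - A * MHBc) := by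
    rw [eSU, eMB]
    have e1 : MBL = A - MHB := by linarith [eMBsplit, eMB]
    have e2 : Abar = 1 - A := by linarith
    have e3 : MHBc = 1 - ML - MHB := by linarith
    rw [e1, e2, e3]; ring
  rw [step1]
  -- ### Step 2: `X ≥ T_u`, `Y = T_{ab}`
  set TU := ∑ k ∈ range (K + 1), ∑ k' ∈ range (K + 1), ∑ j ∈ range N,
      if k < r ∧ r ≤ k' ∧ t ≤ k' + j ∧ k + j < t then a k * u k' j else 0 with hTU
  set T1 := ∑ k ∈ range (K + 1), ∑ k' ∈ range (K + 1), ∑ j ∈ range N,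
      if k < r ∧ r ≤ k' ∧ t ≤ k' + j ∧ k + j < t then a k * (a k' * b j) else 0 with hT1
  have hX : TU ≤ Abar * SUHB - A * SUHBc := by
    rw [hAbar, hA, hSUHB, hSUHBc, step2_identity (K + 1) N a u r t, ← hTU]
    have : 0 ≤ ∑ k ∈ range (K + 1), ∑ k' ∈ range (K + 1), ∑ j ∈ range N,
        if k < r ∧ r ≤ k' ∧ t ≤ k + j then a k * u k' j - a k' * u k j else 0 := by
      refine Finset.sum_nonneg fun k _ => Finset.sum_nonneg fun k' _ => Finset.sum_nonneg fun j _ => ?_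
      split_ifs with h
      · have := F1 k k' j (by omega); linarith
      · exact le_rfl
    linarith
  have hY : Abar * MHB - A * MHBc = T1 := by
    rw [hAbar, hA, hMHB, hMHBc, step2_identity (K + 1) N a (fun k j => a k * b j) r t, ← hT1]
    have : (∑ k ∈ range (K + 1), ∑ k' ∈ range (K + 1), ∑ j ∈ range N,
        if k < r ∧ r ≤ k' ∧ t ≤ k + j then a k * (a k' * b j) - a k' * (a k * b j) else 0) = 0 := by
      refine Finset.sum_eq_zero fun k _ => Finset.sum_eq_zero fun k' _ => Finset.sum_eq_zero fun j _ => ?_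
      split_ifs <;> ring
    rw [this, add_zero]
  rw [hY]
  -- ### Step 3: `ML · TU ≥ SUL · T1` (level transport)
  -- opaque row data (kept atomic to keep terms small): column CDF `F`, source values `st`, source weights `αt`,
  -- band weights `W`, band values `Wu`, target weights `βt`, target values `tt`
  obtain ⟨F, hF⟩ : ∃ F : ℕ → ℝ, ∀ m, F m = ∑ j ∈ range N, if m + j < t then b j else 0 := ⟨_, fun _ => rfl⟩
  obtain ⟨st, hst⟩ : ∃ st : ℕ → ℝ, ∀ m, st m = ∑ j ∈ range N, if m + j < t then u m j else 0 := ⟨_, fun _ => rfl⟩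
  obtain ⟨W, hW⟩ : ∃ W : ℕ → ℕ → ℝ, ∀ k k', W k k' = ∑ j ∈ range N, if t ≤ k' + j ∧ k + j < t then b j else 0 :=
    ⟨_, fun _ _ => rfl⟩
  obtain ⟨Wu, hWu⟩ : ∃ Wu : ℕ → ℕ → ℝ, ∀ k k', Wu k k' = ∑ j ∈ range N, if t ≤ k' + j ∧ k + j < t then u k' j else 0 :=
    ⟨_, fun _ _ => rfl⟩
  obtain ⟨αt, hαt⟩ : ∃ αt : ℕ → ℝ, ∀ m, αt m = a m * F m := ⟨_, fun _ => rfl⟩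
  obtain ⟨βt, hβt⟩ : ∃ βt : ℕ → ℕ → ℝ, ∀ k k', βt k k' = a k * a k' * W k k' := ⟨_, fun _ _ => rfl⟩
  obtain ⟨tt, htt⟩ : ∃ tt : ℕ → ℕ → ℝ, ∀ k k', tt k k' = a k * Wu k k' := ⟨_, fun _ _ => rfl⟩
  have hF0 : ∀ m, 0 ≤ F m := fun m => by rw [hF]; exact Finset.sum_nonneg fun j _ => by split_ifs <;> simp [hb j]
  have hst0 : ∀ m, 0 ≤ st m := fun m => by rw [hst]; exact Finset.sum_nonneg fun j _ => by split_ifs <;> simp [hu m j]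
  have hW0 : ∀ k k', 0 ≤ W k k' := fun k k' => by rw [hW]; exact Finset.sum_nonneg fun j _ => by split_ifs <;> simp [hb j]
  have hWu0 : ∀ k k', 0 ≤ Wu k k' := fun k k' => by rw [hWu]; exact Finset.sum_nonneg fun j _ => by split_ifs <;> simp [hu k' j]
  have hαt0 : ∀ m, 0 ≤ αt m := fun m => by rw [hαt]; exact mul_nonneg (ha m) (hF0 m)
  have hβt0 : ∀ k k', 0 ≤ βt k k' := fun k k' => by rw [hβt]; exact mul_nonneg (mul_nonneg (ha k) (ha k')) (hW0 k k')
  have htt0 : ∀ k k', 0 ≤ tt k k' := fun k k' => by rw [htt]; exact mul_nonneg (ha k) (hWu0 k k')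
  have hst_le : ∀ m, st m ≤ αt m := fun m => by
    rw [hst, hαt, hF, Finset.mul_sum]
    refine Finset.sum_le_sum fun j _ => ?_
    split_ifs
    · exact hub m j
    · simp
  have hiii : ∀ m, αt m = 0 → st m = 0 := fun m h => le_antisymm (h ▸ hst_le m) (hst0 m)
  -- the column CDF is antitone, bands are differences of balls
  have hFanti : ∀ m m', m ≤ m' → F m' ≤ F m := fun m m' h => by rw [hF, hF]; exact ball_sum_antitone N b hb h
  have hWF : ∀ k k', k ≤ k' → W k k' = F k - F k' := fun k k' h => by rw [hW, hF, hF]; exact band_sum_eq_sub N b h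
  -- LEMMA S≤T for every admissible triple
  have hST : ∀ k m k', k ≤ m → m ≤ k' → st m * βt k k' ≤ αt m * tt k k' := by
    intro k m k' hkm hmk'
    have h := source_mul_le_target_mul N u a b ha hb F1 F2 (k := k) (m := m) (k' := k') (t := t) hkm hmk'
    rw [← hst, ← hW, ← hWu, ← hF] at h
    rw [hβt, hαt, htt]
    have hak : 0 ≤ a k := ha k
    calc st m * (a k * a k' * W k k') = a k * (st m * a k' * W k k') := by ring
      _ ≤ a k * (Wu k k' * a m * F m) := mul_le_mul_of_nonneg_left h hak
      _ = a m * F m * (a k * Wu k k') := by ring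
  -- the four global sums in row form
  have eML : ML = ∑ m ∈ range (K + 1), αt m := by
    rw [hML]; refine Finset.sum_congr rfl fun m _ => ?_
    rw [hαt, hF, Finset.mul_sum]
    refine Finset.sum_congr rfl fun j _ => ?_
    split_ifs <;> simp
  have eSUL : SUL = ∑ m ∈ range (K + 1), st m := by
    rw [hSUL]; exact Finset.sum_congr rfl fun m _ => (hst m).symm
  have eT1 : T1 = ∑ k ∈ range (K + 1), ∑ k' ∈ range (K + 1), if k < r ∧ r ≤ k' then βt k k' else 0 := by
    rw [hT1]; refine Finset.sum_congr rfl fun k _ => Finset.sum_congr rfl fun k' _ => ?_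
    rw [hβt, hW, Finset.mul_sum]
    by_cases h : k < r ∧ r ≤ k'
    · rw [if_pos h]; refine Finset.sum_congr rfl fun j _ => ?_
      by_cases h' : t ≤ k' + j ∧ k + j < t
      · rw [if_pos ⟨h.1, h.2, h'.1, h'.2⟩, if_pos h']; ring
      · rw [if_neg (fun hh => h' ⟨hh.2.2.1, hh.2.2.2⟩), if_neg h']; ring
    · rw [if_neg h]; refine Finset.sum_eq_zero fun j _ => ?_
      rw [if_neg (fun hh => h ⟨hh.1, hh.2.1⟩)]
  have eTU : TU = ∑ k ∈ range (K + 1), ∑ k' ∈ range (K + 1), if k < r ∧ r ≤ k' then tt k k' else 0 := by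
    rw [hTU]; refine Finset.sum_congr rfl fun k _ => Finset.sum_congr rfl fun k' _ => ?_
    rw [htt, hWu, Finset.mul_sum]
    by_cases h : k < r ∧ r ≤ k'
    · rw [if_pos h]; refine Finset.sum_congr rfl fun j _ => ?_
      by_cases h' : t ≤ k' + j ∧ k + j < t
      · rw [if_pos ⟨h.1, h.2, h'.1, h'.2⟩, if_pos h']
      · rw [if_neg (fun hh => h' ⟨hh.2.2.1, hh.2.2.2⟩), if_neg h']; ring
    · rw [if_neg h]; refine Finset.sum_eq_zero fun j _ => ?_
      rw [if_neg (fun hh => h ⟨hh.1, hh.2.1⟩)]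
  -- aggregated targets (opaque)
  obtain ⟨βK, hβK⟩ : ∃ f : ℕ → ℝ, ∀ k, f k = ∑ k' ∈ range (K + 1), if r ≤ k' then βt k k' else 0 := ⟨_, fun _ => rfl⟩
  obtain ⟨tK, htK⟩ : ∃ f : ℕ → ℝ, ∀ k, f k = ∑ k' ∈ range (K + 1), if r ≤ k' then tt k k' else 0 := ⟨_, fun _ => rfl⟩
  obtain ⟨βK', hβK'⟩ : ∃ f : ℕ → ℝ, ∀ k', f k' = ∑ k ∈ range (K + 1), if k < r then βt k k' else 0 := ⟨_, fun _ => rfl⟩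
  obtain ⟨tK', htK'⟩ : ∃ f : ℕ → ℝ, ∀ k', f k' = ∑ k ∈ range (K + 1), if k < r then tt k k' else 0 := ⟨_, fun _ => rfl⟩
  have hβK0 : ∀ k, 0 ≤ βK k := fun k => by rw [hβK]; exact Finset.sum_nonneg fun k' _ => by split_ifs <;> simp [hβt0 k k']
  have htK0 : ∀ k, 0 ≤ tK k := fun k => by rw [htK]; exact Finset.sum_nonneg fun k' _ => by split_ifs <;> simp [htt0 k k']
  have hβK'0 : ∀ k', 0 ≤ βK' k' := fun k' => by rw [hβK']; exact Finset.sum_nonneg fun k _ => by split_ifs <;> simp [hβt0 k k']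
  have htK'0 : ∀ k', 0 ≤ tK' k' := fun k' => by rw [htK']; exact Finset.sum_nonneg fun k _ => by split_ifs <;> simp [htt0 k k']
  -- T1, TU as low sums and as high sums
  have range_split : ∀ f : ℕ → ℝ, (∑ k ∈ range (K + 1), f k) = (∑ k ∈ range r, f k) + ∑ k ∈ Ico r (K + 1), f k := by
    intro f
    rw [Finset.range_eq_Ico, Finset.range_eq_Ico]
    exact (Finset.sum_Ico_consecutive f (Nat.zero_le r) hr).symm
  have low_form : ∀ (g : ℕ → ℕ → ℝ) (G : ℕ → ℝ), (∀ k, G k = ∑ k' ∈ range (K + 1), if r ≤ k' then g k k' else 0) →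
      (∑ k ∈ range (K + 1), ∑ k' ∈ range (K + 1), if k < r ∧ r ≤ k' then g k k' else 0) = ∑ k ∈ range r, G k := by
    intro g G hG
    rw [range_split]
    have hz : (∑ k ∈ Ico r (K + 1), ∑ k' ∈ range (K + 1), if k < r ∧ r ≤ k' then g k k' else 0) = 0 := by
      refine Finset.sum_eq_zero fun k hk => Finset.sum_eq_zero fun k' _ => ?_
      rw [Finset.mem_Ico] at hk; rw [if_neg (fun h => by omega)]
    rw [hz, add_zero]
    refine Finset.sum_congr rfl fun k hk => ?_
    rw [Finset.mem_range] at hk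
    rw [hG]; refine Finset.sum_congr rfl fun k' _ => ?_
    by_cases h : r ≤ k'
    · rw [if_pos ⟨hk, h⟩, if_pos h]
    · rw [if_neg (fun hh => h hh.2), if_neg h]
  have high_form : ∀ (g : ℕ → ℕ → ℝ) (G : ℕ → ℝ), (∀ k', G k' = ∑ k ∈ range (K + 1), if k < r then g k k' else 0) →
      (∑ k ∈ range (K + 1), ∑ k' ∈ range (K + 1), if k < r ∧ r ≤ k' then g k k' else 0) = ∑ k' ∈ Ico r (K + 1), G k' := by
    intro g G hG
    rw [Finset.sum_comm, range_split]
    have hz : (∑ k' ∈ range r, ∑ k ∈ range (K + 1), if k < r ∧ r ≤ k' then g k k' else 0) = 0 := by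
      refine Finset.sum_eq_zero fun k' hk' => Finset.sum_eq_zero fun k _ => ?_
      rw [Finset.mem_range] at hk'; rw [if_neg (fun h => by omega)]
    rw [hz, zero_add]
    refine Finset.sum_congr rfl fun k' hk' => ?_
    rw [Finset.mem_Ico] at hk'
    rw [hG]; refine Finset.sum_congr rfl fun k _ => ?_
    by_cases h : k < r
    · rw [if_pos ⟨h, hk'.1⟩, if_pos h]
    · rw [if_neg (fun hh => h hh.1), if_neg h]
  have eT1low : T1 = ∑ k ∈ range r, βK k := by rw [eT1]; exact low_form βt βK hβK
  have eTUlow : TU = ∑ k ∈ range r, tK k := by rw [eTU]; exact low_form tt tK htK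
  have eT1high : T1 = ∑ k' ∈ Ico r (K + 1), βK' k' := by rw [eT1]; exact high_form βt βK' hβK'
  have eTUhigh : TU = ∑ k' ∈ Ico r (K + 1), tK' k' := by rw [eTU]; exact high_form tt tK' htK'
  -- likelihood-ratio monotonicity of the pairs (αt, βt)
  have hmlr_t : ∀ k m k', k ≤ m → αt k * βt m k' ≤ αt m * βt k k' := by
    intro k m k' hkm
    rw [hαt, hαt, hβt, hβt]
    by_cases hmk' : m ≤ k'
    · rw [hWF k k' (by omega), hWF m k' hmk']
      have hkm' : F m ≤ F k := hFanti k m hkm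
      have hprod : 0 ≤ a k * a m * a k' := mul_nonneg (mul_nonneg (ha k) (ha m)) (ha k')
      have key : 0 ≤ a k * a m * a k' * F k' * (F k - F m) := mul_nonneg (mul_nonneg hprod (hF0 k')) (sub_nonneg.2 hkm')
      rw [← sub_nonneg]
      have e : a m * F m * (a k * a k' * (F k - F k')) - a k * F k * (a m * a k' * (F m - F k')) =
          a k * a m * a k' * F k' * (F k - F m) := by ring
      rw [e]; exact key
    · have hz : W m k' = 0 := by
        rw [hW]; refine Finset.sum_eq_zero fun j _ => ?_; rw [if_neg (fun hh => by omega)]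
      rw [hz, mul_zero, mul_zero]
      exact mul_nonneg (mul_nonneg (ha m) (hF0 m)) (mul_nonneg (mul_nonneg (ha k) (ha k')) (hW0 k k'))
  have hmlr_t' : ∀ k m k', k < r → r ≤ m → m ≤ k' → αt k' * βt k m ≤ αt m * βt k k' := by
    intro k m k' hk hm hmk'
    rw [hαt, hαt, hβt, hβt, hWF k m (by omega), hWF k k' (by omega)]
    have h2 : F k' ≤ F m := hFanti m k' hmk'
    have hprod : 0 ≤ a k * a m * a k' := mul_nonneg (mul_nonneg (ha k) (ha m)) (ha k')
    have key : 0 ≤ a k * a m * a k' * F k * (F m - F k') := mul_nonneg (mul_nonneg hprod (hF0 k)) (sub_nonneg.2 h2)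
    rw [← sub_nonneg]
    have e : a m * F m * (a k * a k' * (F k - F k')) - a k' * F k' * (a k * a m * (F k - F m)) =
        a k * a m * a k' * F k * (F m - F k') := by ring
    rw [e]; exact key
  -- ### LOW part: sources `m < r` against targets `k ≤ m`
  have low : (∑ m ∈ range r, st m) * (∑ k ∈ range r, βK k) ≤ (∑ m ∈ range r, αt m) * (∑ k ∈ range r, tK k) := by
    refine transport_low r αt st βK tK hαt0 hst0 hβK0 htK0 ?_ ?_ hiii
    · intro k m hkm hm
      rw [hβK, htK, Finset.mul_sum, Finset.mul_sum]
      refine Finset.sum_le_sum fun k' _ => ?_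
      by_cases h : r ≤ k'
      · rw [if_pos h, if_pos h]; exact hST k m k' hkm (by omega)
      · rw [if_neg h, if_neg h, mul_zero, mul_zero]
    · intro x hx
      have hmlr : ∀ k m, k ≤ m → αt k * βK m ≤ αt m * βK k := by
        intro k m hkm
        rw [hβK, hβK, Finset.mul_sum, Finset.mul_sum]
        refine Finset.sum_le_sum fun k' _ => ?_
        by_cases h : r ≤ k'
        · rw [if_pos h, if_pos h]; exact hmlr_t k m k' hkm
        · rw [if_neg h, if_neg h, mul_zero, mul_zero]
      have hsplit : ∀ f : ℕ → ℝ, (∑ m ∈ range r, f m) = (∑ m ∈ range (x + 1), f m) + ∑ m ∈ Ico (x + 1) r, f m := by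
        intro f; rw [Finset.range_eq_Ico, Finset.range_eq_Ico]
        exact (Finset.sum_Ico_consecutive f (Nat.zero_le _) (by omega : x + 1 ≤ r)).symm
      rw [hsplit βK, hsplit αt, mul_add, mul_add]
      have cross := cross_sum_mul_le (range (x + 1)) (Ico (x + 1) r) αt βK fun m hm k hk => by
        rw [Finset.mem_range] at hm; rw [Finset.mem_Ico] at hk
        exact hmlr m k (by omega)
      nlinarith only [cross, mul_comm (∑ m ∈ range (x + 1), αt m) (∑ m ∈ range (x + 1), βK m)]
  -- ### HIGH part: sources `m ≥ r` against targets `k' ≥ m`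
  have high : (∑ m ∈ Ico r (K + 1), st m) * (∑ k' ∈ Ico r (K + 1), βK' k') ≤
      (∑ m ∈ Ico r (K + 1), αt m) * (∑ k' ∈ Ico r (K + 1), tK' k') := by
    refine transport_high r (K + 1) αt st βK' tK' hαt0 hst0 hβK'0 htK'0 ?_ ?_ hiii
    · intro m k' hm hmk' hk'
      rw [hβK', htK', Finset.mul_sum, Finset.mul_sum]
      refine Finset.sum_le_sum fun k hk => ?_
      by_cases h : k < r
      · rw [if_pos h, if_pos h]; exact hST k m k' (by omega) hmk'
      · rw [if_neg h, if_neg h, mul_zero, mul_zero]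
    · intro x hx hxK
      have hmlr : ∀ m k', r ≤ m → m ≤ k' → αt k' * βK' m ≤ αt m * βK' k' := by
        intro m k' hm hmk'
        rw [hβK', hβK', Finset.mul_sum, Finset.mul_sum]
        refine Finset.sum_le_sum fun k _ => ?_
        by_cases h : k < r
        · rw [if_pos h, if_pos h]; exact hmlr_t' k m k' h hm hmk'
        · rw [if_neg h, if_neg h, mul_zero, mul_zero]
      have hsplit : ∀ f : ℕ → ℝ, (∑ m ∈ Ico r (K + 1), f m) = (∑ m ∈ Ico r x, f m) + ∑ m ∈ Ico x (K + 1), f m := by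
        intro f; exact (Finset.sum_Ico_consecutive f hx (by omega : x ≤ K + 1)).symm
      rw [hsplit βK', hsplit αt, mul_add, mul_add]
      have cross := cross_sum_mul_le (Ico x (K + 1)) (Ico r x) αt βK' fun m hm m' hm' => by
        rw [Finset.mem_Ico] at hm hm'
        exact hmlr m' m hm'.1 (by omega)
      nlinarith only [cross, mul_comm (∑ m ∈ Ico x (K + 1), αt m) (∑ m ∈ Ico x (K + 1), βK' m)]
  -- ### assemble Step 3
  have step3 : SUL * T1 ≤ ML * TU := by
    rw [eSUL, eML, range_split st, range_split αt, add_mul, add_mul]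
    have l1 : (∑ m ∈ range r, st m) * T1 ≤ (∑ m ∈ range r, αt m) * TU := by rw [eT1low, eTUlow]; exact low
    have l2 : (∑ m ∈ Ico r (K + 1), st m) * T1 ≤ (∑ m ∈ Ico r (K + 1), αt m) * TU := by
      rw [eT1high, eTUhigh]; exact high
    linarith only [l1, l2]
  -- ### conclusion
  have hX' : ML * TU ≤ ML * (Abar * SUHB - A * SUHBc) := mul_le_mul_of_nonneg_left hX hML0
  have hT1nn : 0 ≤ SUL := hSUL0
  nlinarith only [hX', step3, hSUL0, hML0]

end SahiOneStep

end Summit.CriticalPhenomena.PercolationContinuityZ3.Theorems
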